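import Mathlib
import HarnessLib
import Summits.HubbardSuperconductivity.HubbardSuperconductivity.Theorems.KLProgrammeKLRegimeSectorSliceGramVectorsRegime
import Summits.HubbardSuperconductivity.HubbardSuperconductivity.Theorems.KLProgrammeKLRegimeSectorRadialAlignment

/-!
# Route `KLProgramme` — ENGINE child stmt-HubbardSuperconductivity-20236 `KLRegimeEngineV16`, `stub_engine_step_values` (Wick scheme: the SOFT partner
# lines `D_{n′} = klSoftCov … n′` of p1's `klw_rung_pairs`): `κ²`, the Gram constant and the explicit Gram vectors of the FAT-sectorised SOFT lines under
# EXACTLY the gen-6 stub binders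

Cell gate-hubbard-kl, seat hubbard-kl-k3c2-p3 (g4, row «sector-counting import (DR2000 L11/L12) for the leg-dress bar»).  By `klSoftCov_eq_sliceCT_nScales_succ`
(…SectorRadialAlignment, p516258) the soft covariance IS a slice, `D_{n′} = C^K_{(Λ_{n_β+1}, Λ_{n′}]}`, so the pairing-robust regime bounds of
…SectorSliceGramRegime (p515376) / …SectorSliceGramVectorsRegime (p518576) apply with `Λ := Λ_{n_β+1}` (the shift factor is `Λ_n/Λ_{n_β+1} = 4^{n_β+1−n}`,
i.e. the soft line costs the expected `β`-type factor relative to the slice):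

* **`gram_entry_klSoftCov_bgmFat_klEng`** — `∃ Cκ > 0`: under the stub binders, for the fat family of index `n` (`1 ≤ n`) and every `n ≤ n′ ≤ nScales β + 1`,
  `‖(S(Ft_n)ᵀ·klSoftCov n′·S(Ft_n))(Y,Y′)‖ ≤ Cκ·(Λ_n/Λ_{n_β+1})·e₀·8^{−n}` and the `IsGramBoundedR` twin;
* **`gram_vectors_klSoftCov_bgmFat_klEng`** — the explicit Gram vectors (symbol of `hubbardCovSliceCT_zero_seed` at `(Λ_{n_β+1}, Λ_{n′})`) have norm
  `≤ √(same)`; `hGram`/`hC` are `contr_sectorSub_sliceCT_eq_inner` / `sectorSub_sliceCT_apply_of_charge_eq` after the same rewrite.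

Everything is proved; no definitions, no named facts. [cite: BenfattoGiulianiMastropietro2006, §2.8 (2.80)]
-/

noncomputable section

namespace Summit.HubbardSuperconductivity.HubbardSuperconductivity.Theorems.TorusFourierL2

set_option linter.dupNamespace false -- summit = problem name (single-conjunct summit), D-0017

open Set Finset Literature.MathematicalPhysics.QuantumLattice Literature.MathematicalPhysics.QuantumLattice.BandSectorCounting
open Literature.MathematicalPhysics.QuantumLattice.FermiRG Literature.Probability.LatticeModels Literature.Analysis.SpecialFunctions
open Summit.HubbardSuperconductivity.HubbardSuperconductivity.Theorems.DispersionFlow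
open Summit.HubbardSuperconductivity.HubbardSuperconductivity.Theorems.KLRegimeSplit
open Summit.HubbardSuperconductivity.HubbardSuperconductivity.Theorems.KLProgrammeLegKernels
open Summit.HubbardSuperconductivity.HubbardSuperconductivity.Theorems.PerturbedFermiCurve
open Summit.HubbardSuperconductivity.HubbardSuperconductivity.Theorems.KLRegimeWick
open scoped Real

/-- **`κ²` / Gram constant of the fat-sectorised SOFT lines under the stub binders**: fat index `n` (`1 ≤ n`), soft covariance `klSoftCov n′`,
`n ≤ n′ ≤ nScales β + 1`: entries `≤ Cκ·(Λ_n/Λ_{n_β+1})·e₀·8^{-n}` and the `IsGramBoundedR` twin. [cite: BenfattoGiulianiMastropietro2006, §2.8 (2.80)] -/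
theorem gram_entry_klSoftCov_bgmFat_klEng :
    ∃ Cκ : ℝ, 0 < Cκ ∧ ∀ (P : SplitConsts) (R : RenConsts) (c : ℝ), P.WF → R.WF2 → 0 < c → c ≤ EngineV8.klEngC₃3 P R →
      ∀ μ ∈ klWindowC, ∀ U : ℝ, 0 < U → U ≤ EngineV8.klEngU₀4 P R c → ∀ β : ℝ, klBetaMin ≤ β → β ≤ Real.exp (c / U ^ 2) →
      ∀ K : TrigPolyC4v, FrameOK R U (nScales β) μ K → ∀ (L M : ℕ) [NeZero L] [NeZero M],
      EngineV8.klEngL₃ β U ≤ L → EngineV8.klEngM₃ β U L ≤ M → ∀ n : ℕ, 1 ≤ n → ∀ n' : ℕ, n ≤ n' → n' ≤ nScales β + 1 →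
        (∀ Y Y' : SpaceTimeIdx L M × SectorLeg (sectorCount n),
          ‖((sectorSubMatrix L M β (bgmFatMultiplier L M klE0 β (nambuXiCT L μ K) n)).transpose *
              klSoftCov L M β μ K n' * sectorSubMatrix L M β (bgmFatMultiplier L M klE0 β (nambuXiCT L μ K) n)) Y Y'‖ ≤
            Cκ * (klScale klE0 n / klScale klE0 (nScales β + 1)) * (klE0 * ((8 : ℝ) ^ n)⁻¹)) ∧
        IsGramBoundedR ((sectorSubMatrix L M β (bgmFatMultiplier L M klE0 β (nambuXiCT L μ K) n)).transpose *
              klSoftCov L M β μ K n' * sectorSubMatrix L M β (bgmFatMultiplier L M klE0 β (nambuXiCT L μ K) n))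
          (Real.sqrt (Cκ * (klScale klE0 n / klScale klE0 (nScales β + 1)) * (klE0 * ((8 : ℝ) ^ n)⁻¹))) := by
  obtain ⟨Cκ, hCκ, h⟩ := gram_entry_sliceCT_bgmFat_klEng
  refine ⟨Cκ, hCκ, ?_⟩
  intro P R c hP hR2 hc hc3 μ hμ U hU hU0 β hβmin hβc K hK L M _ _ hL3 hM3 n hn n' hnn' hn'N
  rw [klSoftCov_eq_sliceCT_nScales_succ hβmin μ K n']
  obtain ⟨m, rfl⟩ : ∃ m, n = m + 1 := ⟨n - 1, by omega⟩
  have he : (0 : ℝ) < klE0 := by norm_num [klE0]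
  have hanti : ∀ {a b : ℕ}, a ≤ b → klScale klE0 b ≤ klScale klE0 a := fun hab' => by
    unfold klScale; exact mul_le_mul_of_nonneg_left (inv_anti₀ (by positivity) (pow_le_pow_right₀ (by norm_num) hab')) he.le
  exact h P R c hP hR2 hc hc3 μ hμ U hU hU0 β hβmin hβc K hK L M hL3 hM3 m (by omega) (klScale klE0 (nScales β + 1)) (klScale klE0 n')
    (klth_klScale_pos _) (hanti hn'N) (hanti (by omega))

/-- **The explicit Gram vectors of the fat-sectorised SOFT lines under the stub binders** (symbol of `hubbardCovSliceCT_zero_seed` at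
`(Λ_{n_β+1}, Λ_{n′})`, which IS `klSoftCov n′` by `klSoftCov_eq_sliceCT_nScales_succ`): norms `≤ √(Cκ·(Λ_n/Λ_{n_β+1})·e₀·8^{-n})`.
[cite: BenfattoGiulianiMastropietro2006, §2.8 (2.80)] -/
theorem gram_vectors_klSoftCov_bgmFat_klEng :
    ∃ Cκ : ℝ, 0 < Cκ ∧ ∀ (P : SplitConsts) (R : RenConsts) (c : ℝ), P.WF → R.WF2 → 0 < c → c ≤ EngineV8.klEngC₃3 P R →
      ∀ μ ∈ klWindowC, ∀ U : ℝ, 0 < U → U ≤ EngineV8.klEngU₀4 P R c → ∀ β : ℝ, klBetaMin ≤ β → β ≤ Real.exp (c / U ^ 2) →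
      ∀ K : TrigPolyC4v, FrameOK R U (nScales β) μ K → ∀ (L M : ℕ) [NeZero L] [NeZero M],
      EngineV8.klEngL₃ β U ≤ L → EngineV8.klEngM₃ β U L ≤ M → ∀ n : ℕ, 1 ≤ n → ∀ n' : ℕ, n ≤ n' → n' ≤ nScales β + 1 →
        (∀ Y : SpaceTimeIdx L M × SectorLeg (sectorCount n),
          ‖sectorGramF L M β (bgmFatMultiplier L M klE0 β (nambuXiCT L μ K) n)
              (fun ks => ((hubbardCutoffWeightCT L M β μ K (klScale klE0 (nScales β + 1)) ks.1 : ℂ) -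
                  (hubbardCutoffWeightCT L M β μ K (klScale klE0 n') ks.1 : ℂ)) *
                (((β * (L : ℝ) ^ 2 : ℝ) : ℂ) * ((Complex.I * matsubaraFreq β M ks.1.1 + nambuXiCT L μ K ks.1.2) / nambuDenCT L M β μ 0 K ks.1))) Y‖ ≤
            Real.sqrt (Cκ * (klScale klE0 n / klScale klE0 (nScales β + 1)) * (klE0 * ((8 : ℝ) ^ n)⁻¹))) ∧
        (∀ Y' : SpaceTimeIdx L M × SectorLeg (sectorCount n),
          ‖sectorGramG L M β (bgmFatMultiplier L M klE0 β (nambuXiCT L μ K) n)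
              (fun ks => ((hubbardCutoffWeightCT L M β μ K (klScale klE0 (nScales β + 1)) ks.1 : ℂ) -
                  (hubbardCutoffWeightCT L M β μ K (klScale klE0 n') ks.1 : ℂ)) *
                (((β * (L : ℝ) ^ 2 : ℝ) : ℂ) * ((Complex.I * matsubaraFreq β M ks.1.1 + nambuXiCT L μ K ks.1.2) / nambuDenCT L M β μ 0 K ks.1))) Y'‖ ≤
            Real.sqrt (Cκ * (klScale klE0 n / klScale klE0 (nScales β + 1)) * (klE0 * ((8 : ℝ) ^ n)⁻¹))) := by
  have ha : (-4 : ℝ) < -(6 / 5) := by norm_num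
  have hab : (-(6 / 5) : ℝ) ≤ -(1 / 10) := by norm_num
  have hb : (-(1 / 10) : ℝ) < 0 := by norm_num
  obtain ⟨Cκ, hCκ, h⟩ := gram_vectors_sliceCT_bgmFat_of_thresholds ha hab hb
  refine ⟨Cκ, hCκ, ?_⟩
  intro P R c _ hR2 hc hc3 μ hμ U hU hU0 β hβmin hβc K hK L M _ _ hL3 _ n hn n' hnn' hn'N
  obtain ⟨m, rfl⟩ : ∃ m, n = m + 1 := ⟨n - 1, by omega⟩
  have he : (0 : ℝ) < klE0 := by norm_num [klE0]
  have hanti : ∀ {a b : ℕ}, a ≤ b → klScale klE0 b ≤ klScale klE0 a := fun hab' => by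
    unfold klScale; exact mul_le_mul_of_nonneg_left (inv_anti₀ (by positivity) (pow_le_pow_right₀ (by norm_num) hab')) he.le
  have hRj : ∀ j, 0 ≤ R.Gfr j := EngineV8.gfr_nonneg_of_wf2 hR2
  exact h R hRj c U hc (hc3.trans (EngineV8.klEngC₃3_le_symbolC₃ ha hab hb P hRj)) hU
    ((hU0.trans (EngineV8.klEngU₀4_le_klEngU₀3 P R c)).trans (EngineV8.klEngU₀3_le_symbolU₀ ha hab hb P hRj c)) β hβmin hβc μ hμ K hK L M
    (EngineV8.sq_le_of_klEngL₃_le hL3) m (by omega) (klScale klE0 (nScales β + 1)) (klScale klE0 n') (klth_klScale_pos _)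
    (hanti hn'N) (hanti (by omega))

end Summit.HubbardSuperconductivity.HubbardSuperconductivity.Theorems.TorusFourierL2

end
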